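import Summits.QuantumFields.GaugeBoot.LoopEquationMultiplier
import Summits.QuantumFields.GaugeBoot.StrongCouplingWords
import Summits.QuantumFields.GaugeBoot.WordUpdate
import HarnessLib

/-!
# Strong coupling from the loop equation: a loop reading some link exactly once, times spectators avoiding it, is `O(β)` (gauge-boot, ADDENDUM 24 part B)

HONEST FRAMING (cell `pub-gaugeboot`, page 1 of every file): the venture produces certified bounds
on lattice expectations at stated coupling, gauge group, dimension and torus size; NOT a mass gap,
NOT a continuum limit, NOT a string tension; NOT Yang–Mills-summit-bearing (barriers
`FixedCouplingUltralocality`, `PerturbativeInvisibility`).  A crude explicit `O(β)` bound, valid on every torus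
`(ℤ/L)^d` and at every real coupling; it certifies no number of the cell's tables.

## Content

`StrongCouplingOneStep` bounds `E[tr hol w]` when the FIRST letter of `w` reads the marked link and no other letter
does.  The third loop-equation step (ADDENDUM 24) meets 12-letter words whose once-read link sits anywhere, in
either orientation, and multiplied by spectator traces.  This file removes the restrictions:

* `sdPairMul_specialUnitaryGroup` / `sdPairMul_unitaryGroup` — the multiplier identity of `LoopEquationMultiplier`
  holds for `SU(N)` (`s = 1`) and `U(N)` (`s = 0`) for every continuous multiplier ignoring the link;
  `norm_integral_trace_mul_suN_le` / `_uN_le` — the one-step bound with a multiplier in concrete form;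
* `trace_wordHolonomy_append_comm` — ROTATION: `tr ρ(hol_z(u·v)) = tr ρ(hol_{z'}(v·u))` for a closed word split at `z'`;
* `sum_splitTerm_snoc_bwd` — the split sum of a word whose LAST letter reads the marked link BACKWARD (and no other
  letter reads it) is `−(N − s/N)·tr ρ(hol)`; `Word.avoids_of_not_mem_edgesRead` bridges `WordUpdate.edgesRead` to
  `StrongCouplingWords.Word.Avoids`;
* ★★ `norm_integral_trace_mul_suN_le_of_count_eq_one` — **for `SU(N)`, `N ≥ 2`: if a closed word `W` reads the link
  `e` EXACTLY ONCE (`(edgesRead z W).count e = 1`, anywhere, either orientation) and the continuous multiplier `g`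
  ignores `e` and is bounded by `M`, then `‖E[tr hol_z W · g]‖ ≤ 4(d−1)N²M|β|/(N²−1)`** for every `L`, every real
  `β` (tree coupling).  (The `U(N)` twin, `≤ 2(d−1)M|β|`, is the same argument with `norm_integral_trace_mul_uN_le`.)

References: Yu. Makeenko, *Methods of contemporary gauge theory* (2002) Problem 12.7; V. Kazakov, Z. Zheng,
arXiv:2404.16925 §2.3.  Everything is `[folklore]`.
-/

noncomputable section

open MeasureTheory Filter Topology NormedSpace
open scoped Matrix.Norms.Frobenius Matrix
open Literature.MathematicalPhysics.QuantumFieldTheory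
open Summit.QuantumFields.YangMills.Cruxes.CurvatureAmnesia.WardDefect.SchwingerDyson

namespace Summit.QuantumFields.GaugeBoot

variable {d L N : ℕ} {G : Type} [Group G] {ρ : G →* Matrix (Fin N) (Fin N) ℂ}

/-! ## `SU(N)` and `U(N)`: every (traceless) direction is admissible for every edge-independent multiplier -/

section Concrete

open Literature.MathematicalPhysics.QuantumLattice

/-- **`SU(N)`: every traceless direction satisfies the multiplier identity** (for a continuous multiplier ignoring the
link). [folklore] -/
theorem sdPairMul_specialUnitaryGroup [NeZero L] (N : ℕ) (β : ℝ) (x : Site d L) (μ : Fin d) (x₀ : Site d L)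
    (w : Word d) {g : GaugeConfig d L (Matrix.specialUnitaryGroup (Fin N) ℂ) → ℂ} (hg : Continuous g)
    (hge : ∀ (U : GaugeConfig d L (Matrix.specialUnitaryGroup (Fin N) ℂ)) (h : Matrix.specialUnitaryGroup (Fin N) ℂ),
      g (Function.update U (x, μ) h) = g U)
    (X : Matrix (Fin N) (Fin N) ℂ) (hX : X.trace = 0) :
    SDPairMul (fundamentalLatticeRep N) β x μ x₀ w g X := by
  refine sdPairMul_of_traceless (fundamentalLatticeRep N) β x μ x₀ w hg (fun X hXs hX0 => ?_) X hX
  have hmem := mem_oneParamGenerators_specialUnitaryGroup (n := Fin N) (X := X) hXs hX0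
  refine sdPairMul_of_oneParam (fundamentalLatticeRep N) β x μ x₀ w hg hge hXs
    (k := fun t => ⟨NormedSpace.exp (t • X), hmem t⟩) (fun a b => Subtype.ext ?_) (fun t => ?_)
  · change NormedSpace.exp ((a + b) • X) = NormedSpace.exp (a • X) * NormedSpace.exp (b • X)
    rw [add_smul]
    exact Matrix.exp_add_of_commute _ _ (((Commute.refl X).smul_left a).smul_right b)
  · change NormedSpace.exp (t • X) = NormedSpace.exp ((t : ℂ) • X)
    rw [Complex.coe_smul]

/-- **`U(N)`: every direction satisfies the multiplier identity.** [folklore] -/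
theorem sdPairMul_unitaryGroup [NeZero L] (N : ℕ) (β : ℝ) (x : Site d L) (μ : Fin d) (x₀ : Site d L) (w : Word d)
    {g : GaugeConfig d L (Matrix.unitaryGroup (Fin N) ℂ) → ℂ} (hg : Continuous g)
    (hge : ∀ (U : GaugeConfig d L (Matrix.unitaryGroup (Fin N) ℂ)) (h : Matrix.unitaryGroup (Fin N) ℂ),
      g (Function.update U (x, μ) h) = g U)
    (X : Matrix (Fin N) (Fin N) ℂ) : SDPairMul (unitaryFundamentalLatticeRep N) β x μ x₀ w g X := by
  refine sdPairMul_of_skew (unitaryFundamentalLatticeRep N) β x μ x₀ w hg (fun X hXs => ?_) X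
  have hmem := mem_oneParamGenerators_unitaryGroup (n := Fin N) (X := X) hXs
  refine sdPairMul_of_oneParam (unitaryFundamentalLatticeRep N) β x μ x₀ w hg hge hXs
    (k := fun t => ⟨NormedSpace.exp (t • X), hmem t⟩) (fun a b => Subtype.ext ?_) (fun t => ?_)
  · change NormedSpace.exp ((a + b) • X) = NormedSpace.exp (a • X) * NormedSpace.exp (b • X)
    rw [add_smul]
    exact Matrix.exp_add_of_commute _ _ (((Commute.refl X).smul_left a).smul_right b)
  · change NormedSpace.exp (t • X) = NormedSpace.exp ((t : ℂ) • X)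
    rw [Complex.coe_smul]

/-- **One step with a multiplier, `SU(N)`** (`N ≥ 2`, fundamental representation, `s = 1`): if the split terms of the
closed word `w` at `(x, μ)` reduce to `c·tr hol w` with `‖c‖ = N − 1/N`, and the continuous multiplier `g` ignores
the link `(x, μ)` and is bounded by `M`, then `‖E[tr hol w · g]‖ ≤ 4(d−1)N²M|β|/(N²−1)` for every real `β` and every
`L`. [folklore] -/
theorem norm_integral_trace_mul_suN_le [NeZero L] {N : ℕ} (hN : 2 ≤ N) (β : ℝ) (x : Site d L) (μ : Fin d) (w : Word d)
    (hw : Word.endpoint x w = x) {c : ℂ} (hc : ‖c‖ = (N : ℝ) - 1 / N)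
    (hsplit : ∀ U : GaugeConfig d L (Matrix.specialUnitaryGroup (Fin N) ℂ),
      ∑ k ∈ Finset.range w.length, splitTerm (fundamentalRep (Fin N)) 1 x μ U w k =
        c * (fundamentalRep (Fin N) (wordHolonomy U x w)).trace)
    {g : GaugeConfig d L (Matrix.specialUnitaryGroup (Fin N) ℂ) → ℂ} (hg : Continuous g)
    (hge : ∀ (U : GaugeConfig d L (Matrix.specialUnitaryGroup (Fin N) ℂ)) (h : Matrix.specialUnitaryGroup (Fin N) ℂ),
      g (Function.update U (x, μ) h) = g U) {M : ℝ} (hM : ∀ U, ‖g U‖ ≤ M) :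
    ‖∫ U, (fundamentalRep (Fin N) (wordHolonomy U x w)).trace * g U
        ∂(wilsonMeasure (d := d) (L := L) (fundamentalRep (Fin N)) β)‖ ≤
      4 * ((d : ℝ) - 1) * (N : ℝ) ^ 2 * M * |β| / ((N : ℝ) ^ 2 - 1) := by
  have hN2 : (1 : ℝ) < ((fundamentalLatticeRep N).N : ℝ) ^ 2 := by
    rw [fundamentalLatticeRep_N]
    have : (2 : ℝ) ≤ N := by exact_mod_cast hN
    nlinarith
  have h := norm_integral_trace_mul_le (d := d) (L := L) (fundamentalLatticeRep N) β x μ (s := 1) zero_le_one hN2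
    (c := c) (by rw [fundamentalLatticeRep_N, hc]) w hw
    (by intro U; rw [Complex.ofReal_one]; exact hsplit U) hg hM
    (fun i j => by rw [Complex.ofReal_one]; exact sdPairMul_specialUnitaryGroup N β x μ x w hg hge _ (trace_unitDir_one i j))
  simp only [fundamentalLatticeRep_N] at h
  refine h.trans_eq ?_
  ring

/-- **One step with a multiplier, `U(N)`** (`N ≥ 1`, `s = 0`): `‖E[tr hol w · g]‖ ≤ 2(d−1)M|β|`. [folklore] -/
theorem norm_integral_trace_mul_uN_le [NeZero L] {N : ℕ} (hN : 1 ≤ N) (β : ℝ) (x : Site d L) (μ : Fin d) (w : Word d)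
    (hw : Word.endpoint x w = x) {c : ℂ} (hc : ‖c‖ = (N : ℝ))
    (hsplit : ∀ U : GaugeConfig d L (Matrix.unitaryGroup (Fin N) ℂ),
      ∑ k ∈ Finset.range w.length, splitTerm (unitaryFundamentalRep (Fin N) ℂ) 0 x μ U w k =
        c * (unitaryFundamentalRep (Fin N) ℂ (wordHolonomy U x w)).trace)
    {g : GaugeConfig d L (Matrix.unitaryGroup (Fin N) ℂ) → ℂ} (hg : Continuous g)
    (hge : ∀ (U : GaugeConfig d L (Matrix.unitaryGroup (Fin N) ℂ)) (h : Matrix.unitaryGroup (Fin N) ℂ),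
      g (Function.update U (x, μ) h) = g U) {M : ℝ} (hM : ∀ U, ‖g U‖ ≤ M) :
    ‖∫ U, (unitaryFundamentalRep (Fin N) ℂ (wordHolonomy U x w)).trace * g U
        ∂(wilsonMeasure (d := d) (L := L) (unitaryFundamentalRep (Fin N) ℂ) β)‖ ≤ 2 * ((d : ℝ) - 1) * M * |β| := by
  have hNpos : (0 : ℝ) < N := by exact_mod_cast hN
  have hN2 : (0 : ℝ) < ((unitaryFundamentalLatticeRep N).N : ℝ) ^ 2 := by
    rw [unitaryFundamentalLatticeRep_N]; positivity
  have h := norm_integral_trace_mul_le (d := d) (L := L) (unitaryFundamentalLatticeRep N) β x μ (s := 0) le_rfl hN2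
    (c := c) (by simp [unitaryFundamentalLatticeRep_N, hc]) w hw
    (by intro U; rw [Complex.ofReal_zero]; exact hsplit U) hg hM
    (fun i j => by rw [Complex.ofReal_zero]; exact sdPairMul_unitaryGroup N β x μ x w hg hge _)
  simp only [unitaryFundamentalLatticeRep_N, add_zero, sub_zero] at h
  refine h.trans_eq ?_
  field_simp

end Concrete

/-! ## Rotation, the backward split sum, and `edgesRead` versus `Avoids` -/

section Words

/-- **Rotation.**  For `u` from `z` to `z'` and `v` from `z'` back to `z`:
`tr ρ(hol_z(u · v)) = tr ρ(hol_{z'}(v · u))` (cyclicity of the trace). [folklore] -/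
theorem trace_wordHolonomy_append_comm (U : GaugeConfig d L G) (z : Site d L) (u v : Word d)
    (hv : Word.endpoint (Word.endpoint z u) v = z) :
    (ρ (wordHolonomy U z (u ++ v))).trace = (ρ (wordHolonomy U (Word.endpoint z u) (v ++ u))).trace := by
  rw [wordHolonomy_append, wordHolonomy_append, hv, map_mul, map_mul, Matrix.trace_mul_comm]

/-- A word not reading `e` (in the sense of `WordUpdate.edgesRead`) avoids `e` (in the sense of
`StrongCouplingWords.Word.Avoids`). [folklore] -/
theorem Word.avoids_of_not_mem_edgesRead {e : Edge d L} :
    ∀ {z : Site d L} {w : Word d}, e ∉ Word.edgesRead z w → Word.Avoids z w e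
  | z, [], _ => Word.avoids_nil z e
  | z, st :: w, h => by
    rw [Word.edgesRead_cons, List.mem_cons, not_or] at h
    exact Word.avoids_cons (Ne.symm h.1) (Word.avoids_of_not_mem_edgesRead h.2)

/-- Sites visited by a concatenation, inside the first word. [folklore] -/
theorem Word.siteAt_append_of_le (z : Site d L) (v t : Word d) {k : ℕ} (hk : k ≤ v.length) :
    Word.siteAt z (v ++ t) k = Word.siteAt z v k := by
  unfold Word.siteAt
  rw [List.take_append_of_le_length hk]

variable (ρ) in
/-- **The last-letter-backward split sum.**  For `v` from `z` to `z + e_κ` avoiding `(z, κ)`, the word `v · (−κ)` (closed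
at `z`) reads `(z, κ)` only by its last letter, backward: `Σ_k splitTerm_k = −((N − s/N)·tr ρ(hol(v · (−κ))))`.
[folklore] -/
theorem sum_splitTerm_snoc_bwd (s : ℂ) (z : Site d L) (κ : Fin d) (U : GaugeConfig d L G) {v : Word d}
    (hv : Word.Avoids z v (z, κ)) (hvend : Word.endpoint z v = z.shift κ) :
    ∑ k ∈ Finset.range (v ++ [Step.bwd κ] : Word d).length, splitTerm ρ s z κ U (v ++ [.bwd κ]) k =
      -(((N : ℂ) - s / N) * (ρ (wordHolonomy U z (v ++ [.bwd κ]))).trace) := by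
  rw [List.length_append, List.length_singleton, Finset.sum_range_succ]
  have hlast : splitTerm ρ s z κ U (v ++ [.bwd κ]) v.length =
      -(((N : ℂ) - s / N) * (ρ (wordHolonomy U z (v ++ [.bwd κ]))).trace) := by
    have hsite : Word.siteAt z (v ++ [Step.bwd κ] : Word d) v.length = z.shift κ := by
      unfold Word.siteAt; rw [List.take_left, hvend]
    have htake : (v ++ [Step.bwd κ] : Word d).take (v.length + 1) = v ++ [.bwd κ] :=
      List.take_of_length_le (by simp)
    have hdrop : (v ++ [Step.bwd κ] : Word d).drop (v.length + 1) = [] :=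
      List.drop_of_length_le (by simp)
    unfold splitTerm
    rw [List.getElem?_concat_length]
    simp only [hsite, Step.edge_bwd, shift_sub, if_true, Step.isFwd_bwd, Bool.false_eq_true, if_false, htake, hdrop,
      wordHolonomy_nil, map_one, Matrix.trace_one, Fintype.card_fin]
    ring
  have hk : ∀ k ∈ Finset.range v.length, splitTerm ρ s z κ U (v ++ [.bwd κ]) k = 0 := fun k hk => by
    rw [Finset.mem_range] at hk
    obtain ⟨st, hst⟩ : ∃ st, v[k]? = some st := ⟨v[k], List.getElem?_eq_getElem hk⟩
    refine splitTerm_eq_zero_of_edge_ne s z κ U (w := v ++ [.bwd κ]) (k := k) (st := st)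
      (by rw [List.getElem?_append_left hk, hst]) ?_
    rw [Word.siteAt_append_of_le z v _ hk.le]
    exact hv k st hst
  rw [Finset.sum_eq_zero hk, zero_add, hlast]

/-- The word `(+κ) · t` read from `p` reads `(p, κ)` only by its first letter when `t` does not read it:
split sum `(N − s/N)·tr ρ(hol)` (`sum_splitTerm_cons_fwd` in `edgesRead` form). [folklore] -/
theorem sum_splitTerm_cons_fwd_of_not_mem (s : ℂ) (p : Site d L) (κ : Fin d) (U : GaugeConfig d L G) {t : Word d}
    (ht : (p, κ) ∉ Word.edgesRead (p.shift κ) t) :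
    ∑ k ∈ Finset.range (Step.fwd κ :: t : Word d).length, splitTerm ρ s p κ U (.fwd κ :: t) k =
      ((N : ℂ) - s / N) * (ρ (wordHolonomy U p (.fwd κ :: t))).trace :=
  sum_splitTerm_cons_fwd ρ s p κ U (Word.avoids_of_not_mem_edgesRead ht)

end Words

/-! ## The read-once bound -/

section ReadOnce

open Literature.MathematicalPhysics.QuantumLattice

/-- ★★ **THE READ-ONCE BOUND, `SU(N)`** (`N ≥ 2`, fundamental representation, tree coupling `β`).  Let `W` be a word
closed at `z` that reads the link `e` EXACTLY ONCE (anywhere, in either orientation), and `g` a continuous function of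
the configuration that ignores the link `e` (`g(U[e ↦ h]) = g(U)`) with `‖g‖ ≤ M`.  Then, on every torus `(ℤ/L)^d`
and for every real `β`: `‖E[tr hol_z W · g]‖ ≤ 4(d−1)N²·M·|β|/(N² − 1)`.  (Rotate `W` so that the reading letter is
first — forward — or last — backward —, then one loop-equation step with the multiplier.) [folklore] -/
theorem norm_integral_trace_mul_suN_le_of_count_eq_one [NeZero L] {N : ℕ} (hN : 2 ≤ N)
    (β : ℝ) (z : Site d L) (W : Word d) (hW : Word.endpoint z W = z) (e : Edge d L)
    (hcount : (Word.edgesRead z W).count e = 1)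
    {g : GaugeConfig d L (Matrix.specialUnitaryGroup (Fin N) ℂ) → ℂ} (hg : Continuous g)
    (hge : ∀ (U : GaugeConfig d L (Matrix.specialUnitaryGroup (Fin N) ℂ)) (h : Matrix.specialUnitaryGroup (Fin N) ℂ),
      g (Function.update U e h) = g U) {M : ℝ} (hM : ∀ U, ‖g U‖ ≤ M) :
    ‖∫ U, (fundamentalRep (Fin N) (wordHolonomy U z W)).trace * g U
        ∂(wilsonMeasure (d := d) (L := L) (fundamentalRep (Fin N)) β)‖ ≤
      4 * ((d : ℝ) - 1) * (N : ℝ) ^ 2 * M * |β| / ((N : ℝ) ^ 2 - 1) := by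
  have hNpos : (0 : ℝ) < N := by
    have : (2 : ℝ) ≤ N := by exact_mod_cast hN
    linarith
  have hc0 : (0 : ℝ) ≤ (N : ℝ) - 1 / N := by
    rw [sub_nonneg, div_le_iff₀ hNpos]
    have : (1 : ℝ) ≤ N := by exact_mod_cast (le_trans (by norm_num) hN)
    nlinarith
  obtain S := Word.split z W e hcount
  set p : Site d L := Word.endpoint z S.pre with hp
  -- the tail of the word after the prefix returns to `z`
  have hback : Word.endpoint p (S.step :: S.suf) = z := by
    have h := hW
    rw [S.eq, Word.endpoint_append] at h
    exact h
  have hsuf : Word.endpoint (S.step.apply p) S.suf = z := by simpa using hback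
  obtain ⟨step, hstep⟩ : ∃ st, S.step = st := ⟨_, rfl⟩
  cases step with
  | fwd κ =>
    -- `e = (p, κ)`; rotate so that the reading letter comes first
    have he : e = (p, κ) := by rw [← S.step_edge, hstep, Step.edge_fwd]
    set R : Word d := (Step.fwd κ :: S.suf) ++ S.pre with hR
    have hrot : ∀ U : GaugeConfig d L (Matrix.specialUnitaryGroup (Fin N) ℂ),
        (fundamentalRep (Fin N) (wordHolonomy U z W)).trace = (fundamentalRep (Fin N) (wordHolonomy U p R)).trace := by
      intro U
      have h := trace_wordHolonomy_append_comm (ρ := fundamentalRep (Fin N)) U z S.pre (S.step :: S.suf) hback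
      rw [← S.eq, hstep] at h
      exact h
    have hRcl : Word.endpoint p R = p := by
      rw [hR, Word.endpoint_append, ← hstep, hback]
    have htail : (p, κ) ∉ Word.edgesRead (p.shift κ) (S.suf ++ S.pre) := by
      rw [Word.edgesRead_append]
      have h1 : e ∉ Word.edgesRead (p.shift κ) S.suf := by
        have h := S.suf_not_mem; rwa [hstep, Step.apply_fwd] at h
      have h2 : Word.endpoint (p.shift κ) S.suf = z := by rwa [hstep, Step.apply_fwd] at hsuf
      rw [h2, ← he]
      exact List.not_mem_append h1 S.pre_not_mem
    have hsplit : ∀ U : GaugeConfig d L (Matrix.specialUnitaryGroup (Fin N) ℂ),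
        ∑ k ∈ Finset.range R.length, splitTerm (fundamentalRep (Fin N)) 1 p κ U R k =
          ((N : ℂ) - 1 / N) * (fundamentalRep (Fin N) (wordHolonomy U p R)).trace := fun U => by
      rw [hR, List.cons_append]
      exact sum_splitTerm_cons_fwd_of_not_mem 1 p κ U htail
    have hge' : ∀ (U : GaugeConfig d L (Matrix.specialUnitaryGroup (Fin N) ℂ)) (h : Matrix.specialUnitaryGroup (Fin N) ℂ),
        g (Function.update U (p, κ) h) = g U := fun U h => by rw [← he]; exact hge U h
    have hcn : ‖((N : ℂ) - 1 / N)‖ = (N : ℝ) - 1 / N := by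
      rw [show ((N : ℂ) - 1 / N) = (((N : ℝ) - 1 / N : ℝ) : ℂ) by push_cast; ring, Complex.norm_real, Real.norm_eq_abs,
        abs_of_nonneg hc0]
    simp_rw [hrot]
    exact norm_integral_trace_mul_suN_le (d := d) (L := L) hN β p κ R hRcl hcn hsplit hg hge' hM
  | bwd κ =>
    -- `e = (p − e_κ, κ)`; rotate so that the reading letter comes last
    set z' : Site d L := p - Pi.single κ 1 with hz'
    have he : e = (z', κ) := by rw [← S.step_edge, hstep, Step.edge_bwd]
    have happ : (Step.bwd κ).apply p = z' := by rw [Step.apply_bwd]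
    set R : Word d := S.suf ++ (S.pre ++ [Step.bwd κ]) with hR
    have hpre' : Word.endpoint z (S.pre ++ [Step.bwd κ]) = z' := by
      rw [Word.endpoint_append, ← hp, Word.endpoint_cons, Word.endpoint_nil, happ]
    have hsuf' : Word.endpoint z' S.suf = z := by rwa [hstep, happ] at hsuf
    have hrot : ∀ U : GaugeConfig d L (Matrix.specialUnitaryGroup (Fin N) ℂ),
        (fundamentalRep (Fin N) (wordHolonomy U z W)).trace = (fundamentalRep (Fin N) (wordHolonomy U z' R)).trace := by
      intro U
      have hWeq : W = (S.pre ++ [Step.bwd κ]) ++ S.suf :=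
        calc W = S.pre ++ S.step :: S.suf := S.eq
          _ = (S.pre ++ [Step.bwd κ]) ++ S.suf := by rw [hstep, List.append_assoc]; rfl
      have h := trace_wordHolonomy_append_comm (ρ := fundamentalRep (Fin N)) U z (S.pre ++ [Step.bwd κ]) S.suf
        (by rw [hpre', hsuf'])
      rw [← hWeq, hpre'] at h
      exact h
    have hRcl : Word.endpoint z' R = z' := by
      rw [hR, Word.endpoint_append, hsuf', hpre']
    have hR' : R = (S.suf ++ S.pre) ++ [Step.bwd κ] := by rw [hR, List.append_assoc]
    have hvend : Word.endpoint z' (S.suf ++ S.pre) = z'.shift κ := by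
      rw [Word.endpoint_append, hsuf', ← hp, hz', Site.shift, sub_add_cancel]
    have htail : Word.Avoids z' (S.suf ++ S.pre) (z', κ) := by
      refine Word.avoids_of_not_mem_edgesRead ?_
      rw [Word.edgesRead_append, hsuf', ← he]
      have h1 : e ∉ Word.edgesRead z' S.suf := by
        have h := S.suf_not_mem; rwa [hstep, happ] at h
      exact List.not_mem_append h1 S.pre_not_mem
    have hsplit : ∀ U : GaugeConfig d L (Matrix.specialUnitaryGroup (Fin N) ℂ),
        ∑ k ∈ Finset.range R.length, splitTerm (fundamentalRep (Fin N)) 1 z' κ U R k =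
          (-((N : ℂ) - 1 / N)) * (fundamentalRep (Fin N) (wordHolonomy U z' R)).trace := fun U => by
      rw [hR', sum_splitTerm_snoc_bwd (fundamentalRep (Fin N)) 1 z' κ U htail hvend]
      ring
    have hge' : ∀ (U : GaugeConfig d L (Matrix.specialUnitaryGroup (Fin N) ℂ)) (h : Matrix.specialUnitaryGroup (Fin N) ℂ),
        g (Function.update U (z', κ) h) = g U := fun U h => by rw [← he]; exact hge U h
    have hcn : ‖(-((N : ℂ) - 1 / N))‖ = (N : ℝ) - 1 / N := by
      rw [norm_neg, show ((N : ℂ) - 1 / N) = (((N : ℝ) - 1 / N : ℝ) : ℂ) by push_cast; ring, Complex.norm_real,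
        Real.norm_eq_abs, abs_of_nonneg hc0]
    simp_rw [hrot]
    exact norm_integral_trace_mul_suN_le (d := d) (L := L) hN β z' κ R hRcl hcn hsplit hg hge' hM

end ReadOnce

end Summit.QuantumFields.GaugeBoot

end
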